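import Summits.FinalStateConjecture.FinalStateConjecture.Theorems.EIHFluxBalanceInertialRecessionStubHigherOrderSummands

/-!
# Route EIHFluxBalance — `InertialRecession` (E′), line `SketchCleanExcision`, skeleton r13,
# stub `stub_higherOrderSlaving` (EF): the parameter boxes of the own hole and of the far holes

Helper file for the crux `stmt-FinalStateConjecture-17403`
(`Summit.FinalStateConjecture.FinalStateConjecture.Theses.EIHFluxBalance.InertialRecession`, E′),
registered stub `stub_higherOrderSlaving` (orders two and three of frozen-vacuum slaving).

* `higherOrder_inverse_lorentzBox` — the inverse `S = Λ⁻¹` of a Lorentz frame with Lorentz factor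
  `≤ γ` is a Lorentz isometry with `|(S e₀)⁰| ≤ γ` (the `00` entries of `Λ` and `Λ⁻¹` agree);
* `higherOrder_far_box` — scaled by the lab distance `ρ = ‖x − c‖ ≥ max(1, 2|a|)` to a far hole,
  the rest position `(x − c)/ρ` has norm `1` and the scaled painted radius is `≥ ½`
  (boosts stretch spatial vectors, `‖ỹ‖² − a² ≤ r²`, Kerr–Schild scaling of the radius).

These put the scaled parameters of every far summand into ONE compact parameter box of the
variation bounds (`…StubHigherOrderVariation`), uniformly in late times.

No definitions, no named facts, no `sorry`.
-/

set_option linter.dupNamespace false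
set_option maxSynthPendingDepth 6

noncomputable section

namespace Summit.FinalStateConjecture.FinalStateConjecture.Theorems.SublinearIsFree.Slaving

open Set Function Literature.Geometry.Lorentzian
  Summit.FinalStateConjecture.FinalStateConjecture.Theorems

/-- **The inverse frame lies in the Lorentz box of the frame.** [folklore] -/
theorem higherOrder_inverse_lorentzBox (Λ : lorentzGroup) {γ : ℝ}
    (h : |((Λ : E4 ≃L[ℝ] E4) (E4.basisVector 0)) 0| ≤ γ) :
    (∀ v w : E4, Minkowski.bilin ((((Λ : E4 ≃L[ℝ] E4).symm : E4 ≃L[ℝ] E4) : E4 →L[ℝ] E4) v)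
      ((((Λ : E4 ≃L[ℝ] E4).symm : E4 ≃L[ℝ] E4) : E4 →L[ℝ] E4) w) = Minkowski.bilin v w) ∧
    |((((Λ : E4 ≃L[ℝ] E4).symm : E4 ≃L[ℝ] E4) : E4 →L[ℝ] E4) (E4.basisVector 0)) 0| ≤ γ := by
  refine ⟨fun v w ↦ ?_, ?_⟩
  · have h2 := (Λ⁻¹).2 v w
    rw [coe_lorentz_inv] at h2
    exact h2
  · obtain ⟨h0, -, -⟩ := higherOrder_restComponents Λ (E4.basisVector 0)
    have : ((((Λ : E4 ≃L[ℝ] E4).symm : E4 ≃L[ℝ] E4) : E4 →L[ℝ] E4) (E4.basisVector 0)) 0 =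
        ((Λ : E4 ≃L[ℝ] E4) (E4.basisVector 0)) 0 := by
      show ((Λ : E4 ≃L[ℝ] E4).symm (E4.basisVector 0)) 0 = _
      rw [h0, minkowski_bilin_basisVector_zero_left, neg_neg]
    rw [this]; exact h

/-- **The far box.** For a lab point `x` on the slice of the centre `c` (`x⁰ = c⁰`) at lab distance
`ρ = ‖x − c‖ ≥ max(1, 2|a|)` and a Lorentz frame `Λ`: `‖(x − c)/ρ‖ ≤ 1` and the scaled painted
radius `r_{a/ρ}(Λ⁻¹((x − c)/ρ)) ≥ ½`. [folklore] -/
theorem higherOrder_far_box (Λ : lorentzGroup) (c x : E4) (a : ℝ) (hx0 : x 0 = c 0)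
    (h1 : 1 ≤ ‖x - c‖) (h2 : 2 * |a| ≤ ‖x - c‖) :
    ‖‖x - c‖⁻¹ • (x - c)‖ ≤ 1 ∧
    (1 / 2 : ℝ) ≤ Kerr.radius (‖x - c‖⁻¹ * a)
      ((((Λ : E4 ≃L[ℝ] E4).symm : E4 ≃L[ℝ] E4) : E4 →L[ℝ] E4) (‖x - c‖⁻¹ • (x - c))) := by
  set ρ : ℝ := ‖x - c‖ with hρ
  have hρ0 : 0 < ρ := one_pos.trans_le h1
  refine ⟨?_, ?_⟩
  · rw [norm_smul, norm_inv, norm_norm, inv_mul_cancel₀ hρ0.ne']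
  · -- the radius of the unscaled rest position is `≥ ρ/2`
    have hw0 : (x - c) 0 = 0 := by
      show x 0 - c 0 = 0
      rw [hx0, sub_self]
    have hstretch : ρ ≤ E4.spatialNorm ((Λ : E4 ≃L[ℝ] E4).symm (x - c)) := by
      have h := norm_le_spatialNorm_lorentz_apply Λ⁻¹ (w := x - c) hw0
      rwa [coe_lorentz_inv] at h
    have hsq := Kerr.spatialNorm_sq_sub_sq_le_radius_sq a ((Λ : E4 ≃L[ℝ] E4).symm (x - c))
    have hr0 := Kerr.radius_nonneg a ((Λ : E4 ≃L[ℝ] E4).symm (x - c))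
    have ha : |a| ≤ ρ / 2 := by linarith
    have ha2 : a ^ 2 ≤ (ρ / 2) ^ 2 := by
      rw [← sq_abs a]; exact pow_le_pow_left₀ (abs_nonneg a) ha 2
    have hsn2 : ρ ^ 2 ≤ E4.spatialNorm ((Λ : E4 ≃L[ℝ] E4).symm (x - c)) ^ 2 :=
      pow_le_pow_left₀ hρ0.le hstretch 2
    have hrad : ρ / 2 ≤ Kerr.radius a ((Λ : E4 ≃L[ℝ] E4).symm (x - c)) := by
      have h3 : (ρ / 2) ^ 2 ≤ Kerr.radius a ((Λ : E4 ≃L[ℝ] E4).symm (x - c)) ^ 2 := by nlinarith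
      exact (pow_le_pow_iff_left₀ (by positivity) hr0 two_ne_zero).1 h3
    -- scale
    have hscale := higherOrder_summand_radius Λ c a hρ0 x
    rw [hscale]
    show (1 / 2 : ℝ) ≤ ρ⁻¹ * Kerr.radius a ((Λ : E4 ≃L[ℝ] E4).symm (x - c))
    rw [le_inv_mul_iff₀ hρ0]
    linarith

/-- **Registered one-line carrier form** (`higherOrder_farBox_EF`) of `higherOrder_far_box`.
[folklore] -/
theorem higherOrder_farBox_EF : open Literature.Geometry.Lorentzian in ∀ (Λ : lorentzGroup) (c x : E4) (a : ℝ), x 0 = c 0 → 1 ≤ ‖x - c‖ → 2 * |a| ≤ ‖x - c‖ → ‖‖x - c‖⁻¹ • (x - c)‖ ≤ 1 ∧ (1 / 2 : ℝ) ≤ Kerr.radius (‖x - c‖⁻¹ * a) ((((Λ : E4 ≃L[ℝ] E4).symm : E4 ≃L[ℝ] E4) : E4 →L[ℝ] E4) (‖x - c‖⁻¹ • (x - c))) :=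
  fun Λ c x a hx0 h1 h2 ↦ higherOrder_far_box Λ c x a hx0 h1 h2

end Summit.FinalStateConjecture.FinalStateConjecture.Theorems.SublinearIsFree.Slaving

end
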